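import Literature.Topology.FourManifolds.SignatureProductCircle
import Literature.Topology.FourManifolds.Recharted
import Literature.Topology.FourManifolds.SpinDiffeomorphProofs
import Literature.Topology.FourManifolds.SmoothOrientationProd
import Literature.Topology.FourManifolds.SmoothHomologicalOrientationProofs
import Literature.Topology.FourManifolds.IntersectionLatticeOrientationIffProofs
import Literature.AlgebraicTopology.SingularHomology.OrientationCover
import Literature.Geometry.Manifold.ModelChange
import Mathlib.Geometry.Manifold.Instances.Sphere
import Mathlib.Analysis.InnerProductSpace.PiL2
import HarnessLib

/-!
# Orientations of recharted manifolds; `N³ × S¹` and `F × T²` are oriented, of signature zero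

Topic `Literature/Topology/FourManifolds`.  J. M. Lee, *Introduction to Smooth Manifolds* (2nd
ed., 2013), Prop. 15.6 / Example 15.18 and Prop. 15.33 (orientations under local
diffeomorphisms; products of orientable manifolds — "`𝕋ⁿ = 𝕊¹ × ⋯ × 𝕊¹` is orientable"), and
M. W. Hirsch, *Differential Topology* (1976), Ch. 4 §4 and Ch. 5 §1 (the product orientation).
R. Kirby, *The topology of 4-manifolds* (1989), Ch. II §5, p. 27: the signature of `M³ × S¹`
vanishes.

`Literature.Geometry.Manifold.Rechart f M` recharts a manifold `M` modelled on `(H, I)` along a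
homeomorphism of model spaces `f : H ≃ₜ E'` reading as a linear isomorphism `L : E ≃L[ℝ] E'`
(`f h = L (I h)`); this is how the tree turns Mathlib's product manifolds `N × Circle`,
`F × Circle × Circle` (charted on `ModelProd`) into manifolds charted on `ℝⁿ`
(`SignatureProductCircle.lean`, `FourTorusSignature.lean`).  The refactor note of
`ModelChange.lean` asks for the orientation API of the older `Recharted X L` (normed-space model
only) on `Rechart`; this file supplies the part needed to ORIENT those models, everything PROVED
(no definition, no named fact):

* `tangentCoordChange_rechart` — for a boundaryless source model, **the tangent coordinate
  changes of `Rechart f M` are those of `M` conjugated by `L`** (`Recharted.tangentCoordChange_eq`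
  generalised from `𝓘(ℝ, E)` to any boundaryless `(H, I)`).
* `IsOrientable.rechart` — hence **`Rechart f M` is orientable when `M` is** (transport the
  pointwise orientations along `L`; conjugation does not change determinants,
  `det_continuousLinearEquiv_conj`; Lee 2013, Prop. 15.6).
* `isOrientable_circle` — **Mathlib's Lie group `Circle ⊆ ℂ` is orientable**: the linear isometry
  `ℂ ≃ₗᵢ[ℝ] ℝ²` (`Complex.orthonormalBasisOneI`) restricts to a diffeomorphism
  `Circle ≃ₘ 𝕊¹ ⊆ ℝ²`, and `𝕊¹` is orientable (`isOrientable_sphere_holds`, Hirsch §4.4;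
  `IsOrientable.of_diffeomorph`).
* `isOrientableOver_int_rechart_prod_circle` — **`N × S¹`, recharted on `ℝᵈ⁺¹`, is `ℤ`-orientable
  for every orientable `N`** (product orientation `IsOrientable.prod`, Hirsch Ch. 5 §1; then the
  homological orientation compatible with the smooth one, Bredon VI.7.15,
  `SmoothOrientation.existsUnique_isCompatible_holds`).
* `exists_prodCircle_oriented_model_of_orientation` — **`N³ × S¹` for ANY closed connected
  `ℤ`-oriented smooth `3`-manifold `N`**: a closed connected smooth `4`-manifold `X ≃ₜ N × S¹`
  charted on `ℝ⁴` which is `ℤ`-orientable and all of whose `ℤ`-orientations have signature `0`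
  (`signature_prodCircle_eq_zero`, Kirby II §5 p. 27) — `FourTorusSignature.lean` had this only
  for topological groups `N`.
* `exists_surface_prod_torus_oriented_model` — **`F × T²` for any closed connected `ℤ`-oriented
  smooth surface `F`**: a closed connected smooth `ℤ`-ORIENTABLE `4`-manifold
  `X ≃ₜ (F × S¹) × S¹` with all signatures `0` — the oriented form of
  `exists_surface_prod_torus_model`; with `F = Σ₂` this is the manifold `Σ₂ × T²` from which
  A. Akhmedov, B. D. Park (Invent. Math. 181 (2010), §2) obtain `Y₁(1/p, 1/q)` by Luttinger
  surgeries, `σ(Σ₂ × T²) = 0` being the first summand of "`σ(X₁(m)) = 0 + (-1)`" (§9, proof of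
  Lemma 8).  The Luttinger-surgery invariance of `σ` is NOT formalised here.

## References

* J. M. Lee, *Introduction to Smooth Manifolds*, 2nd ed., Springer GTM 218 (2013), Prop. 15.6,
  Example 15.18, Prop. 15.33. [LeeSmoothManifolds2013]
* M. W. Hirsch, *Differential Topology*, GTM 33, Springer (1976), Ch. 4 §4, Ch. 5 §1. [HirschDT1976]
* R. C. Kirby, *The topology of 4-manifolds*, LNM 1374, Springer (1989), Ch. II §5 p. 27. [Kirby1989]
* A. Akhmedov, B. D. Park, Invent. Math. 181 (2010) 577–603, §2 and §9. [AkhmedovPark2010]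
-/

noncomputable section

open Set Function Module
open scoped Manifold ContDiff Topology
open Literature.AlgebraicTopology.SingularHomology
open Literature.Geometry.Manifold (Rechart)

namespace Literature.Topology.FourManifolds

/-! ### Tangent coordinate changes and orientations of `Rechart f M` -/

section RechartOrientation

variable {E H E' : Type*} [NormedAddCommGroup E] [NormedSpace ℝ E] [TopologicalSpace H]
  {I : ModelWithCorners ℝ E H} [NormedAddCommGroup E'] [NormedSpace ℝ E']
  (f : H ≃ₜ E') (L : E ≃L[ℝ] E') (M : Type*) [TopologicalSpace M] [ChartedSpace H M]

/-- The inverse change of model reads as `f⁻¹ = I⁻¹ ∘ L⁻¹` when `f = L ∘ I`. [folklore] -/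
theorem rechart_symm_apply (hIf : ∀ h, f h = L (I h)) (e' : E') : f.symm e' = I.symm (L.symm e') := by
  have h := Homeomorph.symm_apply_eq_linear (I := I) (I' := 𝓘(ℝ, E')) f L
    (fun h => by rw [modelWithCornersSelf_coe, id_eq]; exact hIf h) e'
  rw [modelWithCornersSelf_coe, id_eq] at h
  rw [← h, I.left_inv]

/-- **The tangent coordinate changes of `Rechart f M` are those of `M` conjugated by `L`** (for a
boundaryless source model `I`, so that both are honest Fréchet derivatives): the extended charts
of `Rechart f M` are `L ∘ (extended charts of M)`, so the transition maps are conjugated by `L`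
(Lee 2013, proof of Prop. 1.17: the transition maps of compatible atlases). [folklore] -/
theorem tangentCoordChange_rechart [I.Boundaryless] [IsManifold I 1 M]
    [IsManifold 𝓘(ℝ, E') 1 (Rechart f M)] (hIf : ∀ h, f h = L (I h)) (x y z : Rechart f M) :
    tangentCoordChange 𝓘(ℝ, E') x y z =
      (L : E →L[ℝ] E').comp ((tangentCoordChange I (Rechart.out f M x) (Rechart.out f M y)
        (Rechart.out f M z)).comp (L.symm : E' →L[ℝ] E)) := by
  have hsymm := rechart_symm_apply f L hIf
  rw [tangentCoordChange_def, tangentCoordChange_def]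
  simp only [modelWithCornersSelf_coe, range_id, fderivWithin_univ, ModelWithCorners.range_eq_univ]
  have hfun : (⇑(extChartAt 𝓘(ℝ, E') y) ∘ ⇑(extChartAt 𝓘(ℝ, E') x).symm) =
      (L : E → E') ∘ (⇑(extChartAt I (Rechart.out f M y)) ∘
        ⇑(extChartAt I (Rechart.out f M x)).symm) ∘ (L.symm : E' → E) := by
    funext e'
    simp only [comp_apply, extChartAt_coe, extChartAt_coe_symm, modelWithCornersSelf_coe,
      modelWithCornersSelf_coe_symm, id_eq, Rechart.chartAt_def, Rechart.chart_apply,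
      Rechart.chart_symm_apply, Rechart.out_into, hIf, hsymm]
  have hpt : extChartAt 𝓘(ℝ, E') x z = L (extChartAt I (Rechart.out f M x) (Rechart.out f M z)) := by
    simp only [extChartAt_coe, comp_apply, modelWithCornersSelf_coe, id_eq, Rechart.chartAt_def,
      Rechart.chart_apply, hIf]
  rw [hfun, hpt, L.comp_fderiv, L.symm.comp_right_fderiv, L.symm_apply_apply]

/-- **A recharted orientable manifold is orientable** (Lee 2013, Prop. 15.6: orientations pull
back along local diffeomorphisms; here the identity `Rechart f M → M`): at `x` take the
orientation of `M` at `x` transported along `L` (`orientationCongr`); local constancy transfers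
because the tangent coordinate changes are conjugated by `L` (`tangentCoordChange_rechart`), which
preserves determinants (`det_continuousLinearEquiv_conj`).
[cite: LeeSmoothManifolds2013, Prop. 15.6] -/
theorem IsOrientable.rechart [I.Boundaryless] [IsManifold I 1 M]
    [IsManifold 𝓘(ℝ, E') 1 (Rechart f M)] (hIf : ∀ h, f h = L (I h)) (hM : IsOrientable I M) :
    IsOrientable 𝓘(ℝ, E') (Rechart f M) := by
  obtain ⟨o⟩ := hM
  refine ⟨{ toFun := fun x => orientationCongr L (o (Rechart.out f M x))
            eventually_eq_iff' := fun x => ?_ }⟩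
  have h := o.eventually_eq_iff (Rechart.out f M x)
  filter_upwards [(Rechart.continuous_out f M).continuousAt.eventually h] with y hy
  rw [(orientationCongr L).apply_eq_iff_eq, hy, tangentCoordChange_rechart f L M hIf,
    det_continuousLinearEquiv_conj]

end RechartOrientation

/-! ### The circle is orientable -/

section CircleOrientation

/-- **Mathlib's unit circle `Circle ⊆ ℂ` is an orientable `1`-manifold** (Lee 2013, Example 15.18;
Hirsch §4.4): the linear isometry `ℂ ≃ₗᵢ[ℝ] ℝ²` of the orthonormal basis `(1, i)`
(`Complex.orthonormalBasisOneI`) restricts to a diffeomorphism of `Circle` onto the unit sphere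
`𝕊¹ ⊆ ℝ²` (smooth in both directions by `ContMDiff.codRestrict_sphere`, `contMDiff_coe_sphere`),
and `𝕊¹` is orientable (the tree's `isOrientable_sphere_holds`); orientability is a diffeomorphism
invariant (`IsOrientable.of_diffeomorph`). [cite: LeeSmoothManifolds2013, Example 15.18] [cite: HirschDT1976, §4.4] -/
theorem isOrientable_circle : IsOrientable (𝓡 1) Circle := by
  haveI hC : Fact (finrank ℝ ℂ = 1 + 1) := finrank_real_complex_fact'
  haveI hE : Fact (finrank ℝ (EuclideanSpace ℝ (Fin 2)) = 1 + 1) := ⟨by simp⟩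
  let φ : ℂ ≃ₗᵢ[ℝ] EuclideanSpace ℝ (Fin 2) := Complex.orthonormalBasisOneI.repr
  have hφ : ∀ z : Circle, φ z ∈ Metric.sphere (0 : EuclideanSpace ℝ (Fin 2)) 1 := fun z => by
    rw [mem_sphere_zero_iff_norm, φ.norm_map, Circle.norm_coe]
  have hφ' : ∀ w : Metric.sphere (0 : EuclideanSpace ℝ (Fin 2)) 1,
      φ.symm w ∈ Metric.sphere (0 : ℂ) 1 := fun w => by
    rw [mem_sphere_zero_iff_norm, φ.symm.norm_map, norm_eq_of_mem_sphere w]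
  let ψ : Circle ≃ₘ⟮𝓡 1, 𝓡 1⟯ (Metric.sphere (0 : EuclideanSpace ℝ (Fin 2)) 1) :=
    { toFun := Set.codRestrict (fun z : Circle => φ z) _ hφ
      invFun := Set.codRestrict (fun w : Metric.sphere (0 : EuclideanSpace ℝ (Fin 2)) 1 =>
        φ.symm w) (Metric.sphere (0 : ℂ) 1) hφ'
      left_inv := fun z => Subtype.ext (φ.symm_apply_apply (z : ℂ))
      right_inv := fun w => Subtype.ext (φ.apply_symm_apply (w : EuclideanSpace ℝ (Fin 2)))
      contMDiff_toFun := by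
        apply ContMDiff.codRestrict_sphere
        exact φ.toContinuousLinearEquiv.contDiff.contMDiff.comp contMDiff_coe_sphere
      contMDiff_invFun := by
        apply ContMDiff.codRestrict_sphere
        exact φ.symm.toContinuousLinearEquiv.contDiff.contMDiff.comp contMDiff_coe_sphere }
  exact (isOrientable_sphere_holds 1).of_diffeomorph ψ.symm (by simp)

end CircleOrientation

/-! ### `N × S¹` recharted on `ℝᵈ⁺¹` is `ℤ`-orientable for orientable `N` -/

section ProdCircle

/-- **`N × S¹`, recharted on `ℝᵈ⁺¹`, is `ℤ`-orientable when `N` is orientable.** For a Hausdorff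
`C^∞` manifold `N` charted on `ℝᵈ` with a smooth orientation, and the recharting
`X = Rechart f (N × Circle)` of Mathlib's product manifold along `f = L ∘ ((𝓡 d).prod (𝓡 1))`,
`L : ℝᵈ × ℝ¹ ≃L ℝᵈ⁺¹`: `N × Circle` carries the product orientation (`IsOrientable.prod`, Hirsch
Ch. 5 §1, with `isOrientable_circle`), `X` the recharted one (`IsOrientable.rechart`), and a
smooth orientation of a manifold charted on `ℝⁿ` determines a homological `ℤ`-orientation
(Bredon VI.7.15, `SmoothOrientation.existsUnique_isCompatible_holds`).
[cite: HirschDT1976, Ch. 5 §1] [cite: LeeSmoothManifolds2013, Prop. 15.33] -/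
theorem isOrientableOver_int_rechart_prod_circle {d : ℕ} (N : Type) [TopologicalSpace N]
    [T2Space N] [ChartedSpace (EuclideanSpace ℝ (Fin d)) N] [IsManifold (𝓡 d) ∞ N]
    (hN : IsOrientable (𝓡 d) N)
    (f : ModelProd (EuclideanSpace ℝ (Fin d)) (EuclideanSpace ℝ (Fin 1)) ≃ₜ
      EuclideanSpace ℝ (Fin (d + 1)))
    (L : (EuclideanSpace ℝ (Fin d) × EuclideanSpace ℝ (Fin 1)) ≃L[ℝ] EuclideanSpace ℝ (Fin (d + 1)))
    (hIf : ∀ x, f x = L (((𝓡 d).prod (𝓡 1)) x)) :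
    IsOrientableOver ℤ (Rechart f (N × Circle)) (d + 1) := by
  have hf := Rechart.contMDiff_of_apply_eq_linear (I := (𝓡 d).prod (𝓡 1)) (n := ∞) f L hIf
  have hf' := Rechart.contMDiff_symm_of_apply_eq_linear (I := (𝓡 d).prod (𝓡 1)) (n := ∞) f L hIf
  haveI hX : IsManifold (𝓡 (d + 1)) ∞ (Rechart f (N × Circle)) := Rechart.isManifold f _ hf hf'
  have hO : IsOrientable (𝓡 (d + 1)) (Rechart f (N × Circle)) :=
    IsOrientable.rechart f L (N × Circle) hIf (hN.prod isOrientable_circle)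
  obtain ⟨o⟩ := hO
  obtain ⟨g⟩ : Nonempty (HomologicalOrientation ℤ (EuclideanSpace ℝ (Fin (d + 1))) (d + 1)) :=
    isOrientableOver_of_simplyConnectedSpace ℤ (EuclideanSpace ℝ (Fin (d + 1))) (n := d + 1)
  obtain ⟨μ, -, -⟩ := SmoothOrientation.existsUnique_isCompatible_holds (n := d + 1)
    (M := Rechart f (N × Circle)) g o
  exact ⟨μ⟩

/-- **`N³ × S¹` for a closed connected `ℤ`-oriented smooth `3`-manifold `N`: oriented, signature
zero.** For every closed connected smooth `3`-manifold `N` (charted on `ℝ³`, `C^∞`, in `Type`)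
with a homological `ℤ`-orientation there is a closed connected smooth `4`-manifold `X ≃ₜ N × S¹`
charted on `ℝ⁴` which IS `ℤ`-orientable (`isOrientableOver_int_rechart_prod_circle`, the smooth
orientation of `N` coming from the homological one, Bredon VI.7.15,
`nonempty_smoothOrientation_of_homologicalOrientation`) and all of whose `ℤ`-orientations have
signature `0` (`signature_prodCircle_eq_zero`: the reflection of the circle factor reverses the
orientation; Kirby 1989, II §5 p. 27).  `FourTorusSignature.lean` had this for topological
groups `N` only. [cite: Kirby1989, Ch. II §5 p. 27] [cite: LeeSmoothManifolds2013, Prop. 15.33] -/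
theorem exists_prodCircle_oriented_model_of_orientation (N : Type) [TopologicalSpace N] [T2Space N]
    [SecondCountableTopology N] [CompactSpace N] [ConnectedSpace N]
    [ChartedSpace (EuclideanSpace ℝ (Fin 3)) N] [IsManifold (𝓡 3) ∞ N]
    (μN : HomologicalOrientation ℤ N 3) :
    ∃ (X : Type) (_ : TopologicalSpace X) (_ : T2Space X) (_ : SecondCountableTopology X)
      (_ : ChartedSpace (EuclideanSpace ℝ (Fin 4)) X) (_ : IsManifold (𝓡 4) ∞ X)
      (_ : CompactSpace X) (_ : ConnectedSpace X),
      Nonempty (X ≃ₜ N × Circle) ∧ IsOrientableOver ℤ X 4 ∧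
        ∀ μ : HomologicalOrientation ℤ X 4, μ.signature = 0 := by
  let L : (EuclideanSpace ℝ (Fin 3) × EuclideanSpace ℝ (Fin 1)) ≃L[ℝ] EuclideanSpace ℝ (Fin 4) :=
    ContinuousLinearEquiv.ofFinrankEq (by simp)
  let f : ModelProd (EuclideanSpace ℝ (Fin 3)) (EuclideanSpace ℝ (Fin 1)) ≃ₜ
      EuclideanSpace ℝ (Fin 4) := L.toHomeomorph
  have hIf : ∀ x, f x = L (((𝓡 3).prod (𝓡 1)) x) := fun x => rfl
  have hf := Rechart.contMDiff_of_apply_eq_linear (I := (𝓡 3).prod (𝓡 1)) (n := ∞) f L hIf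
  have hf' := Rechart.contMDiff_symm_of_apply_eq_linear (I := (𝓡 3).prod (𝓡 1)) (n := ∞) f L hIf
  have hX : IsManifold (𝓡 4) ∞ (Rechart f (N × Circle)) := Rechart.isManifold f _ hf hf'
  haveI : SecondCountableTopology (Rechart f (N × Circle)) :=
    inferInstanceAs (SecondCountableTopology (N × Circle))
  haveI : ConnectedSpace (Rechart f (N × Circle)) := inferInstanceAs (ConnectedSpace (N × Circle))
  obtain ⟨g⟩ : Nonempty (HomologicalOrientation ℤ (EuclideanSpace ℝ (Fin 3)) 3) :=
    isOrientableOver_of_simplyConnectedSpace ℤ (EuclideanSpace ℝ (Fin 3)) (n := 3)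
  have hN : IsOrientable (𝓡 3) N := nonempty_smoothOrientation_of_homologicalOrientation N g μN
  have hO : IsOrientableOver ℤ (Rechart f (N × Circle)) 4 :=
    isOrientableOver_int_rechart_prod_circle N hN f L hIf
  exact ⟨Rechart f (N × Circle), inferInstance, inferInstance, inferInstance, inferInstance, hX,
    inferInstance, inferInstance, ⟨Rechart.outHomeomorph f _⟩, hO,
    fun μ => signature_prodCircle_eq_zero f L (fun _ => rfl) μ⟩

/-- **`F × S¹` recharted on `ℝ³` is an ORIENTED closed connected smooth `3`-manifold** for a closed
connected `ℤ`-oriented smooth surface `F` (bookkeeping for `exists_surface_prod_torus_oriented_model`;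
product orientation, Hirsch Ch. 5 §1). [cite: HirschDT1976, Ch. 5 §1] -/
theorem exists_surface_prod_circle_oriented_model (F : Type) [TopologicalSpace F] [T2Space F]
    [SecondCountableTopology F] [CompactSpace F] [ConnectedSpace F]
    [ChartedSpace (EuclideanSpace ℝ (Fin 2)) F] [IsManifold (𝓡 2) ∞ F]
    (μF : HomologicalOrientation ℤ F 2) :
    ∃ (N : Type) (_ : TopologicalSpace N) (_ : T2Space N) (_ : SecondCountableTopology N)
      (_ : ChartedSpace (EuclideanSpace ℝ (Fin 3)) N) (_ : IsManifold (𝓡 3) ∞ N)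
      (_ : CompactSpace N) (_ : ConnectedSpace N) (_ : HomologicalOrientation ℤ N 3),
      Nonempty (N ≃ₜ F × Circle) := by
  let L : (EuclideanSpace ℝ (Fin 2) × EuclideanSpace ℝ (Fin 1)) ≃L[ℝ] EuclideanSpace ℝ (Fin 3) :=
    ContinuousLinearEquiv.ofFinrankEq (by simp)
  let f : ModelProd (EuclideanSpace ℝ (Fin 2)) (EuclideanSpace ℝ (Fin 1)) ≃ₜ
      EuclideanSpace ℝ (Fin 3) := L.toHomeomorph
  have hIf : ∀ x, f x = L (((𝓡 2).prod (𝓡 1)) x) := fun x => rfl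
  have hf := Rechart.contMDiff_of_apply_eq_linear (I := (𝓡 2).prod (𝓡 1)) (n := ∞) f L hIf
  have hf' := Rechart.contMDiff_symm_of_apply_eq_linear (I := (𝓡 2).prod (𝓡 1)) (n := ∞) f L hIf
  have hN : IsManifold (𝓡 3) ∞ (Rechart f (F × Circle)) := Rechart.isManifold f _ hf hf'
  haveI : SecondCountableTopology (Rechart f (F × Circle)) :=
    inferInstanceAs (SecondCountableTopology (F × Circle))
  haveI : ConnectedSpace (Rechart f (F × Circle)) := inferInstanceAs (ConnectedSpace (F × Circle))
  obtain ⟨g⟩ : Nonempty (HomologicalOrientation ℤ (EuclideanSpace ℝ (Fin 2)) 2) :=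
    isOrientableOver_of_simplyConnectedSpace ℤ (EuclideanSpace ℝ (Fin 2)) (n := 2)
  have hF : IsOrientable (𝓡 2) F := nonempty_smoothOrientation_of_homologicalOrientation F g μF
  obtain ⟨μN⟩ := isOrientableOver_int_rechart_prod_circle F hF f L hIf
  exact ⟨Rechart f (F × Circle), inferInstance, inferInstance, inferInstance, inferInstance, hN,
    inferInstance, inferInstance, μN, ⟨Rechart.outHomeomorph f _⟩⟩

/-- **`σ(F × T²) = 0` on an ORIENTED closed smooth `4`-manifold** (Akhmedov–Park 2010, §9:
`σ(Σ₂ × T²) = 0`, the first summand of `σ(X₁(m)) = σ(Y₁(1,1)) + σ(Z''(1,m)) = 0 + (-1)`, the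
manifold `Y₁(1,1)` being obtained from the symplectic `Σ₂ × T²` of §2 by Luttinger surgeries).
For every closed connected `ℤ`-oriented smooth surface `F` there is a closed connected smooth
`4`-manifold `X ≃ₜ (F × S¹) × S¹`, charted on `ℝ⁴` and `C^∞`, which IS `ℤ`-orientable (product
and recharted orientations, `exists_surface_prod_circle_oriented_model`,
`exists_prodCircle_oriented_model_of_orientation`) and all of whose `ℤ`-orientations have
signature `0` — the oriented form of `exists_surface_prod_torus_model`.  The Luttinger-surgery
invariance of `σ` is NOT formalised here. [cite: AkhmedovPark2010, §2 and §9 (proof of Lemma 8)] [cite: Kirby1989, Ch. II §5 p. 27] -/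
theorem exists_surface_prod_torus_oriented_model (F : Type) [TopologicalSpace F] [T2Space F]
    [SecondCountableTopology F] [CompactSpace F] [ConnectedSpace F]
    [ChartedSpace (EuclideanSpace ℝ (Fin 2)) F] [IsManifold (𝓡 2) ∞ F]
    (μF : HomologicalOrientation ℤ F 2) :
    ∃ (X : Type) (_ : TopologicalSpace X) (_ : T2Space X) (_ : SecondCountableTopology X)
      (_ : ChartedSpace (EuclideanSpace ℝ (Fin 4)) X) (_ : IsManifold (𝓡 4) ∞ X)
      (_ : CompactSpace X) (_ : ConnectedSpace X),
      Nonempty (X ≃ₜ (F × Circle) × Circle) ∧ IsOrientableOver ℤ X 4 ∧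
        ∀ μ : HomologicalOrientation ℤ X 4, μ.signature = 0 := by
  obtain ⟨N, _, _, _, _, _, _, _, μN, ⟨eN⟩⟩ := exists_surface_prod_circle_oriented_model F μF
  obtain ⟨X, _, _, _, _, _, _, _, ⟨eX⟩, hO, hσ⟩ := exists_prodCircle_oriented_model_of_orientation N μN
  exact ⟨X, inferInstance, inferInstance, inferInstance, inferInstance, inferInstance, inferInstance,
    inferInstance, ⟨eX.trans (eN.prodCongr (Homeomorph.refl Circle))⟩, hO, hσ⟩

end ProdCircle

end Literature.Topology.FourManifolds
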